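import Literature.Probability.Percolation.TrapPairCrossGeom
import Literature.Probability.Percolation.TrapFencedExit
import HarnessLib

/-!
# The exits of the clean routes of the cross-frame pair step

Topic `Literature/Probability/Percolation`; family `crit-perc` / near-critical percolation on `𝕋`.
A brick of the near-critical arm-separation theorem for four arms in the ADJACENT colour
arrangement (P. Nolin, EJP 13 (2008), Thm. 11, `j = 4`, `σ = BBWW` [arXiv 0711.4948: Thm. 10];
the input `hsepAdj` of `Werner2009_lemma63_of_altSeparation_of_adjSeparation`).

`CrossData.exists_two_clean_routes_of_rot` (`TrapPairCrossGeom.lean`) gives, for two arms of one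
colour landing on the sides `i₁ ≠ i₂` (structures `D₁`, `D₂` in the frames `ρ^{i₁}`, `ρ^{i₂}` of
`ω`), two vertex-disjoint clean routes in actual coordinates, each from a start to the fence site of a
fence of one of the four families (`ExitRef`: structure `D₁`/`D₂`, term from below/from above),
through non-fence sites (`B𝔅`) and the connection of that fence. Read back in the frame of its
structure, such a route is an exit (`TrapExit`, `TrapFencedExit.lean`) of the configuration
`rotConfig iₛ ω`, to which the landing moves apply:

* `CrossData.symm_mem_region₁/₂` — a non-fence site read in the frame of `D₁` (`D₂`) lies in the
  annulus `{n ≤ |v| ≤ 2M}` and is open in `rotConfig i₁ ω` (`rotConfig i₂ ω`);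
* `zUp z k = (z₀, z₁ - 3k)` — the nominal tip of an exit through a fence from above, and
  `trapFrameZoneBelow_subset_trapExitZone`;
* `CrossData.exitBelow₁/exitUp₁/exitBelow₂/exitUp₂` — the four exits, with their projections.

Everything here is proved; no named facts are introduced.

## References

* P. Nolin, Near-critical percolation in two dimensions, *Electron. J. Probab.* 13 (2008), §4.2
  Def. 6–8, §4.4 proof of Lemma 15 (arXiv 0711.4948: Def. 6–8, Lemma 14) [Nolin2008].
-/

noncomputable section

open Set

namespace Literature.Probability.Percolation

open LatticeModels
open PairData (term_isCrossing term_eq tip_mem term_open)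

/-! ### The nominal tip of an exit through a fence from above -/

/-- **The nominal tip** `(z₀, z₁ - 3k)` of an exit through a fence from above with tip `z` and scale
`k`: its corner box `[z₀+k, z₀+2k] × [z₁-2k, z₁-k]` is the corner box of a fenced exit with this tip. [folklore] -/
def zUp (z : Site 2) (k : ℕ) : Site 2 := ![z 0, z 1 - 3 * k]

/-- Coordinates of the nominal tip. [folklore] -/
@[simp] theorem zUp_zero (z : Site 2) (k : ℕ) : zUp z k 0 = z 0 := rfl

/-- Coordinates of the nominal tip. [folklore] -/
@[simp] theorem zUp_one (z : Site 2) (k : ℕ) : zUp z k 1 = z 1 - 3 * k := rfl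

/-- The nominal tip lies on the outer side when the tip is at least `3k` above the lower corner. [folklore] -/
theorem zUp_mem_trapO {M k : ℕ} {z : Site 2} (hz : z ∈ trapO M) (hk : -(2 * (M : ℤ)) + 3 * k ≤ z 1) (hM : 1 ≤ M) :
    zUp z k ∈ trapO M := by
  obtain ⟨hz0, hz1, hz1'⟩ := trapO_coord hz
  rw [mem_trapO, mem_trapD, zUp_zero, zUp_one]
  omega

/-- The mirrored fence zone of a tip lies in the zone of the exit with the nominal tip. [folklore] -/
theorem trapFrameZoneBelow_subset_trapExitZone {M k : ℕ} {z : Site 2} :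
    trapFrameZoneBelow M z k ⊆ trapExitZone M (zUp z k) k := by
  intro v hv
  rw [mem_trapFrameZoneBelow] at hv
  rw [mem_trapExitZone, zUp_zero, zUp_one]
  have := hv.2.2.2
  have hk : (0 : ℤ) ≤ k := by positivity
  exact ⟨hv.1.imp_right fun h => h.1, hv.2.1, hv.2.2.1, by omega, by omega⟩

namespace CrossData

variable {M n k₀ K T₁ T₁' T₂ T₂' i₁ i₂ : ℕ} {ω : SiteConfig (Site 2)}
  (X : CrossData M n k₀ K T₁ T₁' T₂ T₂' (rotConfig i₁ ω) (rotConfig i₂ ω))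

/-! ### Non-fence sites read in the frames -/

/-- The inverse frame map of `D₁` is the inverse rotation. [folklore] -/
theorem symm_eq₁ (hφ₁ : ∀ u, X.φ₁ u = triRotIsoPow i₁ u) (y : Site 2) : X.φ₁.symm y = (triRotIsoPow i₁).symm y := by
  rw [RelIso.symm_apply_eq, hφ₁, RelIso.apply_symm_apply]

/-- **A non-fence site read in the frame of `D₁` lies in the annulus and is open in `rotConfig i₁ ω`.** [folklore] -/
theorem symm_mem_region₁ (hi₁ : i₁ < 6) (hφ₁ : ∀ u, X.φ₁ u = triRotIsoPow i₁ u) (hφ₂ : ∀ u, X.φ₂ u = triRotIsoPow i₂ u)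
    {w : Site 2} (hw : w ∈ X.B𝔅) : X.φ₁.symm w ∈ triAnnSet n (2 * M) ∩ (rotConfig i₁ ω : Set (Site 2)) := by
  have hopen : w ∈ ω := by
    rcases hw.1 with ⟨x, hx, rfl⟩ | ⟨x, hx, rfl⟩
    · have h := X.D₁.AsetB_subset hx
      rw [mem_rotConfig] at h; rwa [hφ₁]
    · have h := X.D₂.AsetB_subset hx
      rw [mem_rotConfig] at h; rwa [hφ₂]
  refine ⟨?_, ?_⟩
  · rcases X.mem_B𝔅 hw with ⟨x, hx, hxw⟩ | ⟨x, hx, hxw⟩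
    · have hv : X.φ₁.symm w = x := by rw [← hxw, RelIso.symm_apply_apply]
      rw [hv]
      rcases hx with hx | ⟨u, c, z, hu, hx⟩ | ⟨u, d, z, hu, hx⟩
      · obtain ⟨i, hi⟩ := hx; exact (X.D₁.supp i x hi).1
      · exact trapD_subset_triAnnSet X.D₁.hnM (Finset.mem_coe.2 ((term_isCrossing hu).subset hx))
      · exact trapD_subset_triAnnSet X.D₁.hnM (Finset.mem_coe.2 ((PairDataB.termUp_isCrossing hu).subset hx))
    · have hv : X.φ₁.symm w = triRotIsoPow ((i₂ + (6 - i₁)) % 6) x := by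
        rw [← hxw, hφ₂, X.symm_eq₁ hφ₁, triRotIsoPow_symm_comp_apply hi₁.le]
      rw [hv, mem_triAnnSet, triNorm_triRotIsoPow, ← mem_triAnnSet]
      rcases hx with hx | ⟨u, c, z, hu, hx⟩ | ⟨u, d, z, hu, hx⟩
      · obtain ⟨i, hi⟩ := hx; exact (X.D₂.supp i x hi).1
      · exact trapD_subset_triAnnSet X.D₂.hnM (Finset.mem_coe.2 ((term_isCrossing hu).subset hx))
      · exact trapD_subset_triAnnSet X.D₂.hnM (Finset.mem_coe.2 ((PairDataB.termUp_isCrossing hu).subset hx))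
  · show X.φ₁.symm w ∈ rotConfig i₁ ω
    rw [mem_rotConfig, ← hφ₁, RelIso.apply_symm_apply]
    exact hopen

/-! ### Swapping the structures -/

/-- The non-fence sites of the swapped data are the same. [folklore] -/
theorem swap_B𝔅 {χ₁ χ₂ : SiteConfig (Site 2)} (Y : CrossData M n k₀ K T₁ T₁' T₂ T₂' χ₁ χ₂) : Y.swap.B𝔅 = Y.B𝔅 := by
  ext v
  simp only [B𝔅, Aset𝔄, FF𝔉, Set.mem_sdiff, Set.mem_union]
  constructor
  · rintro ⟨h1, h2⟩; exact ⟨h1.symm, fun h => h2 h.symm⟩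
  · rintro ⟨h1, h2⟩; exact ⟨h1.symm, fun h => h2 h.symm⟩

/-! ### The exits -/

/-- **The exit through a fence from below of `D₁`** reached by a clean route from the start `a i`
of `D₁`: tip `z`, scale index `jOf`, fence site `m`, the corner crossing of the fence, and the route
read in the frame of `D₁`. [cite: Nolin2008, §4.2 Def. 6–8 and §4.4 (arXiv 0711.4948: Def. 6–8, Lemma 14)] -/
def exitBelow₁ (hi₁ : i₁ < 6) (hφ₁ : ∀ u, X.φ₁ u = triRotIsoPow i₁ u) (hφ₂ : ∀ u, X.φ₂ u = triRotIsoPow i₂ u)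
    {u : ℕ} {c : Finset (Site 2)} {z : Site 2} (hu : (trapDomain M).lowestSeq (rotConfig i₁ ω) u = some (c, z)) (i : Fin 2)
    {S : Set (Site 2)} (hP : PathIn triGraph S (X.φ₁ (X.D₁.a i)) (X.φ₁ (X.D₁.fence hu).m))
    (hS : S ⊆ X.B𝔅 ∪ X.φ₁ '' (X.D₁.fence hu).F) : TrapExit M n k₀ K (rotConfig i₁ ω) where
  z := z
  j := X.D₁.jOf hu
  m := (X.D₁.fence hu).m
  a := X.D₁.a i
  z_mem := tip_mem hu
  j_lt := (X.D₁.jOf_spec hu).1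
  norm_a := X.D₁.norm_a i
  vcross := (X.D₁.fence hu).vcross
  path := by
    have h := pathIn_map_iso X.φ₁.symm hP
    rw [RelIso.symm_apply_apply, RelIso.symm_apply_apply] at h
    refine h.mono ?_
    rintro v ⟨w, hw, rfl⟩
    rcases hS hw with hw | ⟨y, hy, hyw⟩
    · have hr := X.symm_mem_region₁ hi₁ hφ₁ hφ₂ hw
      exact ⟨Or.inl hr.1, hr.2⟩
    · rw [← hyw, RelIso.symm_apply_apply]
      have hF := (X.D₁.fence hu).F_subset hy
      exact ⟨Or.inr (trapFrameZone_subset_trapExitZone hF.1.1.1), fenceSet_subset hF⟩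

/-- The tip of `exitBelow₁`. [folklore] -/
@[simp] theorem exitBelow₁_z (hi₁ : i₁ < 6) (hφ₁ : ∀ u, X.φ₁ u = triRotIsoPow i₁ u) (hφ₂ : ∀ u, X.φ₂ u = triRotIsoPow i₂ u)
    {u : ℕ} {c : Finset (Site 2)} {z : Site 2} (hu : (trapDomain M).lowestSeq (rotConfig i₁ ω) u = some (c, z)) (i : Fin 2)
    {S : Set (Site 2)} (hP : PathIn triGraph S (X.φ₁ (X.D₁.a i)) (X.φ₁ (X.D₁.fence hu).m))
    (hS : S ⊆ X.B𝔅 ∪ X.φ₁ '' (X.D₁.fence hu).F) : (X.exitBelow₁ hi₁ hφ₁ hφ₂ hu i hP hS).z = z := rfl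

/-- The scale of `exitBelow₁`. [folklore] -/
@[simp] theorem exitBelow₁_k (hi₁ : i₁ < 6) (hφ₁ : ∀ u, X.φ₁ u = triRotIsoPow i₁ u) (hφ₂ : ∀ u, X.φ₂ u = triRotIsoPow i₂ u)
    {u : ℕ} {c : Finset (Site 2)} {z : Site 2} (hu : (trapDomain M).lowestSeq (rotConfig i₁ ω) u = some (c, z)) (i : Fin 2)
    {S : Set (Site 2)} (hP : PathIn triGraph S (X.φ₁ (X.D₁.a i)) (X.φ₁ (X.D₁.fence hu).m))
    (hS : S ⊆ X.B𝔅 ∪ X.φ₁ '' (X.D₁.fence hu).F) : (X.exitBelow₁ hi₁ hφ₁ hφ₂ hu i hP hS).k = X.D₁.kOf hu := rfl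

/-- The start of `exitBelow₁`. [folklore] -/
@[simp] theorem exitBelow₁_a (hi₁ : i₁ < 6) (hφ₁ : ∀ u, X.φ₁ u = triRotIsoPow i₁ u) (hφ₂ : ∀ u, X.φ₂ u = triRotIsoPow i₂ u)
    {u : ℕ} {c : Finset (Site 2)} {z : Site 2} (hu : (trapDomain M).lowestSeq (rotConfig i₁ ω) u = some (c, z)) (i : Fin 2)
    {S : Set (Site 2)} (hP : PathIn triGraph S (X.φ₁ (X.D₁.a i)) (X.φ₁ (X.D₁.fence hu).m))
    (hS : S ⊆ X.B𝔅 ∪ X.φ₁ '' (X.D₁.fence hu).F) : (X.exitBelow₁ hi₁ hφ₁ hφ₂ hu i hP hS).a = X.D₁.a i := rfl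

/-- The fence site of `exitBelow₁`. [folklore] -/
@[simp] theorem exitBelow₁_m (hi₁ : i₁ < 6) (hφ₁ : ∀ u, X.φ₁ u = triRotIsoPow i₁ u) (hφ₂ : ∀ u, X.φ₂ u = triRotIsoPow i₂ u)
    {u : ℕ} {c : Finset (Site 2)} {z : Site 2} (hu : (trapDomain M).lowestSeq (rotConfig i₁ ω) u = some (c, z)) (i : Fin 2)
    {S : Set (Site 2)} (hP : PathIn triGraph S (X.φ₁ (X.D₁.a i)) (X.φ₁ (X.D₁.fence hu).m))
    (hS : S ⊆ X.B𝔅 ∪ X.φ₁ '' (X.D₁.fence hu).F) : (X.exitBelow₁ hi₁ hφ₁ hφ₂ hu i hP hS).m = (X.D₁.fence hu).m := rfl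

/-- **The exit through a fence from above of `D₁`** reached by a clean route from the start `a i`
of `D₁`: NOMINAL tip `zUp z kOfUp = (2M, z₁ - 3k)`, scale index `jOfUp`, fence site `m`, the corner
crossing of the fence (below the tip `z`), and the route read in the frame of `D₁`. [cite: Nolin2008, §4.2 Def. 6–8 and §4.4 (arXiv 0711.4948: Def. 6–8, Lemma 14)] -/
def exitUp₁ (hi₁ : i₁ < 6) (hφ₁ : ∀ u, X.φ₁ u = triRotIsoPow i₁ u) (hφ₂ : ∀ u, X.φ₂ u = triRotIsoPow i₂ u)
    {u : ℕ} {d : Finset (Site 2)} {z : Site 2} (hu : (trapDomain M).flip.lowestSeq (rotConfig i₁ ω) u = some (d, z)) (i : Fin 2)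
    {S : Set (Site 2)} (hP : PathIn triGraph S (X.φ₁ (X.D₁.a i)) (X.φ₁ (X.D₁.fenceUp hu).m))
    (hS : S ⊆ X.B𝔅 ∪ X.φ₁ '' (X.D₁.fenceUp hu).F) : TrapExit M n k₀ K (rotConfig i₁ ω) where
  z := zUp z (X.D₁.kOfUp hu)
  j := X.D₁.jOfUp hu
  m := (X.D₁.fenceUp hu).m
  a := X.D₁.a i
  z_mem := by
    have hmid := X.D₁.tip_midUp u d z hu _ (X.D₁.jOfUp_spec hu).1
    have hKM := X.D₁.hKM _ (X.D₁.jOfUp_spec hu).1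
    exact zUp_mem_trapO (tip_mem_trapO (PairDataB.termUp_isCrossing hu))
      (by show -(2 * (M : ℤ)) + 3 * (X.D₁.kOfUp hu : ℤ) ≤ z 1; unfold PairDataB.kOfUp; omega) (by omega)
  j_lt := (X.D₁.jOfUp_spec hu).1
  norm_a := X.D₁.norm_a i
  vcross := by
    have h := (X.D₁.fenceUp hu).vcross
    simp only [zUp_zero, zUp_one, PairDataB.kOfUp] at h ⊢
    convert h using 3 <;> ring
  path := by
    have h := pathIn_map_iso X.φ₁.symm hP
    rw [RelIso.symm_apply_apply, RelIso.symm_apply_apply] at h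
    refine h.mono ?_
    rintro v ⟨w, hw, rfl⟩
    rcases hS hw with hw | ⟨y, hy, hyw⟩
    · have hr := X.symm_mem_region₁ hi₁ hφ₁ hφ₂ hw
      exact ⟨Or.inl hr.1, hr.2⟩
    · rw [← hyw, RelIso.symm_apply_apply]
      have hF := (X.D₁.fenceUp hu).F_subset hy
      exact ⟨Or.inr (trapFrameZoneBelow_subset_trapExitZone hF.1.1.1), fenceSetUp_subset hF⟩

/-- The nominal tip of `exitUp₁`. [folklore] -/
@[simp] theorem exitUp₁_z (hi₁ : i₁ < 6) (hφ₁ : ∀ u, X.φ₁ u = triRotIsoPow i₁ u) (hφ₂ : ∀ u, X.φ₂ u = triRotIsoPow i₂ u)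
    {u : ℕ} {d : Finset (Site 2)} {z : Site 2} (hu : (trapDomain M).flip.lowestSeq (rotConfig i₁ ω) u = some (d, z)) (i : Fin 2)
    {S : Set (Site 2)} (hP : PathIn triGraph S (X.φ₁ (X.D₁.a i)) (X.φ₁ (X.D₁.fenceUp hu).m))
    (hS : S ⊆ X.B𝔅 ∪ X.φ₁ '' (X.D₁.fenceUp hu).F) : (X.exitUp₁ hi₁ hφ₁ hφ₂ hu i hP hS).z = zUp z (X.D₁.kOfUp hu) := rfl

/-- The scale of `exitUp₁`. [folklore] -/
@[simp] theorem exitUp₁_k (hi₁ : i₁ < 6) (hφ₁ : ∀ u, X.φ₁ u = triRotIsoPow i₁ u) (hφ₂ : ∀ u, X.φ₂ u = triRotIsoPow i₂ u)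
    {u : ℕ} {d : Finset (Site 2)} {z : Site 2} (hu : (trapDomain M).flip.lowestSeq (rotConfig i₁ ω) u = some (d, z)) (i : Fin 2)
    {S : Set (Site 2)} (hP : PathIn triGraph S (X.φ₁ (X.D₁.a i)) (X.φ₁ (X.D₁.fenceUp hu).m))
    (hS : S ⊆ X.B𝔅 ∪ X.φ₁ '' (X.D₁.fenceUp hu).F) : (X.exitUp₁ hi₁ hφ₁ hφ₂ hu i hP hS).k = X.D₁.kOfUp hu := rfl

/-- The start of `exitUp₁`. [folklore] -/
@[simp] theorem exitUp₁_a (hi₁ : i₁ < 6) (hφ₁ : ∀ u, X.φ₁ u = triRotIsoPow i₁ u) (hφ₂ : ∀ u, X.φ₂ u = triRotIsoPow i₂ u)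
    {u : ℕ} {d : Finset (Site 2)} {z : Site 2} (hu : (trapDomain M).flip.lowestSeq (rotConfig i₁ ω) u = some (d, z)) (i : Fin 2)
    {S : Set (Site 2)} (hP : PathIn triGraph S (X.φ₁ (X.D₁.a i)) (X.φ₁ (X.D₁.fenceUp hu).m))
    (hS : S ⊆ X.B𝔅 ∪ X.φ₁ '' (X.D₁.fenceUp hu).F) : (X.exitUp₁ hi₁ hφ₁ hφ₂ hu i hP hS).a = X.D₁.a i := rfl

/-- The fence site of `exitUp₁`. [folklore] -/
@[simp] theorem exitUp₁_m (hi₁ : i₁ < 6) (hφ₁ : ∀ u, X.φ₁ u = triRotIsoPow i₁ u) (hφ₂ : ∀ u, X.φ₂ u = triRotIsoPow i₂ u)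
    {u : ℕ} {d : Finset (Site 2)} {z : Site 2} (hu : (trapDomain M).flip.lowestSeq (rotConfig i₁ ω) u = some (d, z)) (i : Fin 2)
    {S : Set (Site 2)} (hP : PathIn triGraph S (X.φ₁ (X.D₁.a i)) (X.φ₁ (X.D₁.fenceUp hu).m))
    (hS : S ⊆ X.B𝔅 ∪ X.φ₁ '' (X.D₁.fenceUp hu).F) : (X.exitUp₁ hi₁ hφ₁ hφ₂ hu i hP hS).m = (X.D₁.fenceUp hu).m := rfl

end CrossData

end Literature.Probability.Percolation
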